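import Mathlib
import Summits.MatrixMultiplication.MatrixMultiplication.Theorems.PrimeTwoFamilies.Negative.Slices
import Summits.MatrixMultiplication.MatrixMultiplication.Theorems.FourierTwoFamiliesModPCyclicReductionTransfer

/-!
# Capacity gadgets give every slice of `PrimeTwoFamilies` — a second, Mathlib-API proof
# (crux stmt-MatrixMultiplication-14308, line `Sketch`, registered stub
# `primeTwoFamiliesAt_of_capacityGadgets`; siege k17/24, variation "Mathlib API route")

CKSU 2005 Conj. 4.7 with prime cyclic hosts, slice `δ` (`PrimeTwoFamiliesAt δ`), from the transfer
target of the capacity-gadget skeleton: for every `ε > 0` and arbitrarily large `m`, direct pairs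
`(P c, Q c)_{c<r}` in `ZMod m` of co-volume `≥ m^{1-ε}` and a zero-error code `W` of words
`Fin L → Fin r` (`L ≥ 1`, every ordered pair of distinct words strongly separated in a coordinate)
with `|W| ≥ (m^L)^{1/2-ε}`.

This file is independent of the lead's bookkeeping (`stub_capBookkeeping`) and lift (`codeLift`):

* thresholds are never computed — every "for `m` large" condition is an `∀ᶠ m in atTop` statement
  obtained from `tendsto_rpow_atTop` / `Filter.Tendsto.eventually_ge_atTop`, the three of them are
  intersected with `Filter.Eventually.and` and discharged to `ℕ` by `tendsto_natCast_atTop_atTop`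
  (`eventually_const_mul_rpow_le`); uniformity in the word length `L` is obtained by raising
  per-letter inequalities to the `L`-th power (`pow_le_pow_left₀`, `Real.rpow_pow_comm`);
* the number of blocks `n = max n₀ ⌈X^{1/(2+δ)}⌉₊`, `X = 2·3^L·m^L` the a-priori bound on the host
  prime, is fixed BEFORE lifting, so only the first `n` code words are lifted (an injective word
  map `Fin n → (Fin L → Fin r)`, `piFinset_sdpp`) and the transferred family
  (`exists_prime_sdpp_of_addEquiv`, route support `CyclicReduction`) is already `Fin n`-indexed.

Exponents: `ε = δ/8`, `α = (2+δ)⁻¹`; the two strict gaps used are `α < 1/2 - ε` and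
`α (2-δ) < 1 - ε` (both polynomial identities in `δ ∈ (0,1]`, `nlinarith`).
-/

-- single-conjunct summit: the mandated namespace repeats `MatrixMultiplication` (summit = sub-problem).
set_option linter.dupNamespace false

namespace Summit.MatrixMultiplication.MatrixMultiplication.Theorems.PrimeTwoFamilies.CapacityGadgetsK17

open Finset Filter
open Summit.MatrixMultiplication.MatrixMultiplication.Theses
open Summit.MatrixMultiplication.MatrixMultiplication.Theorems
open Summit.MatrixMultiplication.MatrixMultiplication.Theorems.PrimeTwoFamilies.Negative

/-- Growth comparison of real powers along `atTop`, in the form used for thresholds: if `a < b`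
then `K * x ^ a ≤ x ^ b` for all large real `x` (from `tendsto_rpow_atTop` at exponent `b - a`). -/
theorem eventually_const_mul_rpow_le (K : ℝ) {a b : ℝ} (hab : a < b) :
    ∀ᶠ x : ℝ in atTop, K * x ^ a ≤ x ^ b := by
  filter_upwards [(tendsto_rpow_atTop (sub_pos.2 hab)).eventually_ge_atTop K,
    eventually_gt_atTop (0 : ℝ)] with x hK hx
  calc K * x ^ a ≤ x ^ (b - a) * x ^ a :=
        mul_le_mul_of_nonneg_right hK (Real.rpow_nonneg hx.le _)
    _ = x ^ b := by rw [← Real.rpow_add hx, sub_add_cancel]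

/-- **Lift of a code to product blocks** (`Fin n`-indexed form).  Letters `(P c, Q c)` are direct
(`hD`); `w : Fin n → (Fin L → Fin r)` is a word map in which every ordered pair of distinct indices
is strongly separated in some coordinate (`hsep`).  Then the blocks `∏ₜ P (w i t)`, `∏ₜ Q (w i t)`
satisfy clause (W) (coordinatewise directness) and clause (X) (at the separating coordinate the
relation would be a forbidden coincidence of a cross difference with a diagonal difference). -/
theorem piFinset_sdpp {K : Type*} [AddCommGroup K] [DecidableEq K] {r L n : ℕ}
    (P Q : Fin r → Finset K)
    (hD : ∀ c : Fin r, ∀ x ∈ P c, ∀ x' ∈ P c, ∀ y ∈ Q c, ∀ y' ∈ Q c,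
      (x - x') + (y - y') = 0 → x = x' ∧ y = y')
    (w : Fin n → Fin L → Fin r)
    (hsep : ∀ i k : Fin n, i ≠ k → ∃ t : Fin L,
      ∀ p ∈ P (w i t), ∀ q ∈ Q (w k t), ∀ c : Fin r, ∀ p' ∈ P c, ∀ q' ∈ Q c, q - p ≠ q' - p') :
    (∀ i : Fin n, ∀ a ∈ Fintype.piFinset fun t => P (w i t),
      ∀ a' ∈ Fintype.piFinset fun t => P (w i t), ∀ b ∈ Fintype.piFinset fun t => Q (w i t),
      ∀ b' ∈ Fintype.piFinset fun t => Q (w i t), (a - a') + (b - b') = 0 → a = a' ∧ b = b') ∧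
    (∀ i j k : Fin n, ∀ a ∈ Fintype.piFinset fun t => P (w i t),
      ∀ a' ∈ Fintype.piFinset fun t => P (w j t), ∀ b ∈ Fintype.piFinset fun t => Q (w j t),
      ∀ b' ∈ Fintype.piFinset fun t => Q (w k t), (a - a') + (b - b') = 0 → i = k) := by
  refine ⟨fun i a ha a' ha' b hb b' hb' h => ?_, fun i j k a ha a' ha' b hb b' hb' h => ?_⟩
  · simp only [Fintype.mem_piFinset] at ha ha' hb hb'
    have hc : ∀ t, a t = a' t ∧ b t = b' t := fun t =>
      hD _ _ (ha t) _ (ha' t) _ (hb t) _ (hb' t) (by simpa using congrFun h t)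
    exact ⟨funext fun t => (hc t).1, funext fun t => (hc t).2⟩
  · simp only [Fintype.mem_piFinset] at ha ha' hb hb'
    by_contra hik
    obtain ⟨t, ht⟩ := hsep i k hik
    have h0 : (a t - a' t) + (b t - b' t) = 0 := by simpa using congrFun h t
    refine ht (a t) (ha t) (b' t) (hb' t) (w j t) (a' t) (ha' t) (b t) (hb t) ?_
    have e : b' t - a t - (b t - a' t) = -((a t - a' t) + (b t - b' t)) := by abel
    rw [h0, neg_zero, sub_eq_zero] at e
    exact e

/-- **Capacity gadgets give the crux, slice by slice** (registered stub
`primeTwoFamiliesAt_of_capacityGadgets` of crux stmt-MatrixMultiplication-14308, line `Sketch`;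
Mathlib-API proof).  If for every `ε > 0` there are arbitrarily large `m`, direct pairs
`(P c, Q c)_{c<r}` in `ZMod m` with `m^{1-ε} ≤ |P c||Q c|` and a zero-error code `W` of words
`Fin L → Fin r` (`1 ≤ L`, distinct words strongly separated in some coordinate) with
`(m^L)^{1/2-ε} ≤ |W|`, then `PrimeTwoFamiliesAt δ` holds for every `0 < δ ≤ 1`.
Proof: `ε = δ/8`, `α = (2+δ)⁻¹`; pick `m` past the three eventualities
`n₀ ≤ m^α`, `2·6^α·m^α ≤ m^{1/2-ε}`, `(2·6^α)^{2-δ}·m^{α(2-δ)} ≤ m^{1-ε}`; with `X = 2·3^L·m^L` and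
`n = max n₀ ⌈X^α⌉₊` one has `n ≤ (2·(6m)^α)^L`, whence `n ≤ |W|` and `n^{2-δ} ≤ (m^{1-ε})^L`; lift
the first `n` words (`piFinset_sdpp`), move to a prime `p ≤ X` (`exists_prime_sdpp_of_addEquiv`),
and `p ≤ X = (X^α)^{2+δ} ≤ n^{2+δ}`. -/
theorem primeTwoFamiliesAt_of_capacityGadgets
    (hC : ∀ ε : ℝ, 0 < ε → ∀ m₀ : ℕ, ∃ m ≥ m₀, ∃ r L : ℕ, ∃ P Q : Fin r → Finset (ZMod m),
      ∃ W : Finset (Fin L → Fin r),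
      (∀ c : Fin r, ∀ x ∈ P c, ∀ x' ∈ P c, ∀ y ∈ Q c, ∀ y' ∈ Q c,
          (x - x') + (y - y') = 0 → x = x' ∧ y = y') ∧
      (∀ i ∈ W, ∀ k ∈ W, i ≠ k → ∃ t : Fin L,
        ∀ p ∈ P (i t), ∀ q ∈ Q (k t), ∀ c : Fin r, ∀ p' ∈ P c, ∀ q' ∈ Q c, q - p ≠ q' - p') ∧
      1 ≤ L ∧
      ((m : ℝ) ^ (L : ℝ)) ^ (1 / 2 - ε) ≤ (W.card : ℝ) ∧
      ∀ c : Fin r, (m : ℝ) ^ (1 - ε) ≤ (((P c).card * (Q c).card : ℕ) : ℝ))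
    {δ : ℝ} (hδ : 0 < δ) (hδ1 : δ ≤ 1) : PrimeTwoFamiliesAt δ := by
  classical
  intro n₀
  /- exponents -/
  set ε : ℝ := δ / 8 with hε
  have hε0 : 0 < ε := by positivity
  have h2δ : (0 : ℝ) < 2 + δ := by positivity
  set α : ℝ := (2 + δ)⁻¹ with hα
  have hα0 : 0 < α := inv_pos.2 h2δ
  have hgap₁ : α < 1 / 2 - ε := by
    rw [hα, inv_eq_one_div, div_lt_iff₀ h2δ]
    nlinarith [mul_pos hδ (by linarith : (0 : ℝ) < 2 - δ)]
  have hgap₂ : α * (2 - δ) < 1 - ε := by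
    rw [hα, inv_mul_eq_div, div_lt_iff₀ h2δ]
    nlinarith [mul_pos hδ (by linarith : (0 : ℝ) < 14 - δ)]
  set κ : ℝ := 2 * 6 ^ α with hκ
  have hκ0 : 0 < κ := by positivity
  /- thresholds, as eventualities in `m` -/
  have hev : ∀ᶠ m : ℕ in atTop, (n₀ : ℝ) * (m : ℝ) ^ (0 : ℝ) ≤ (m : ℝ) ^ α ∧
      κ * (m : ℝ) ^ α ≤ (m : ℝ) ^ (1 / 2 - ε) ∧
      κ ^ (2 - δ) * (m : ℝ) ^ (α * (2 - δ)) ≤ (m : ℝ) ^ (1 - ε) :=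
    tendsto_natCast_atTop_atTop.eventually
      ((eventually_const_mul_rpow_le (n₀ : ℝ) hα0).and
        ((eventually_const_mul_rpow_le κ hgap₁).and (eventually_const_mul_rpow_le _ hgap₂)))
  obtain ⟨m₁, hm₁⟩ := eventually_atTop.1 hev
  /- the gadget level -/
  obtain ⟨m, hm, r, L, P, Q, W, hD, hCode, hL, hWcard, hcov⟩ := hC ε hε0 (max m₁ 1)
  obtain ⟨h0, h1, h2⟩ := hm₁ m (le_trans (le_max_left _ _) hm)
  have hm1 : 1 ≤ m := le_trans (le_max_right _ _) hm
  have hm1R : (1 : ℝ) ≤ m := by exact_mod_cast hm1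
  have hm0R : (0 : ℝ) ≤ m := zero_le_one.trans hm1R
  have hL0 : L ≠ 0 := by omega
  have h6m0 : (0 : ℝ) ≤ 6 * m := by positivity
  /- `T = 2 (6m)^α` and its three properties -/
  set T : ℝ := 2 * (6 * (m : ℝ)) ^ α with hT
  have hTκ : T = κ * (m : ℝ) ^ α := by
    rw [hT, hκ, Real.mul_rpow (by norm_num : (0 : ℝ) ≤ 6) hm0R]; ring
  have h6mα : 1 ≤ (6 * (m : ℝ)) ^ α := Real.one_le_rpow (by linarith) hα0.le
  have hT1 : 1 ≤ T := by rw [hT]; linarith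
  have hT0 : 0 ≤ T := zero_le_one.trans hT1
  have hF0 : (n₀ : ℝ) ≤ T := by
    rw [Real.rpow_zero, mul_one] at h0
    have h' : (m : ℝ) ^ α ≤ (6 * (m : ℝ)) ^ α := Real.rpow_le_rpow hm0R (by linarith) hα0.le
    rw [hT]; linarith
  have hF1 : T ≤ (m : ℝ) ^ (1 / 2 - ε) := hTκ ▸ h1
  have hF2 : T ^ (2 - δ) ≤ (m : ℝ) ^ (1 - ε) := by
    rw [hTκ, Real.mul_rpow hκ0.le (Real.rpow_nonneg hm0R _), ← Real.rpow_mul hm0R]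
    exact h2
  /- the a-priori host bound `X` and the number of blocks `n` -/
  set X : ℝ := ((2 * (3 ^ L * m ^ L) : ℕ) : ℝ) with hX
  have hX6 : X ≤ (6 * (m : ℝ)) ^ L := by
    have h2L : (2 : ℝ) ≤ 2 ^ L := le_self_pow₀ (by norm_num) hL0
    calc X = 2 * 3 ^ L * (m : ℝ) ^ L := by rw [hX]; push_cast; ring
      _ ≤ 2 ^ L * 3 ^ L * (m : ℝ) ^ L := by gcongr
      _ = (6 * (m : ℝ)) ^ L := by rw [mul_pow, ← mul_pow (2 : ℝ) 3 L]; norm_num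
  have hX1 : 1 ≤ X := by
    rw [hX]; exact_mod_cast Nat.one_le_iff_ne_zero.2 (by positivity)
  have hX0 : 0 ≤ X := zero_le_one.trans hX1
  have hXα1 : 1 ≤ X ^ α := Real.one_le_rpow hX1 hα0.le
  have hXα0 : 0 ≤ X ^ α := zero_le_one.trans hXα1
  set n₁ : ℕ := ⌈X ^ α⌉₊ with hn₁
  set n : ℕ := max n₀ n₁ with hn
  -- `n ≤ T ^ L`
  have hn₁T : (n₁ : ℝ) ≤ T ^ L := by
    have hc : (n₁ : ℝ) ≤ 2 * X ^ α := by
      have := Nat.ceil_lt_add_one hXα0; rw [← hn₁] at this; linarith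
    have hXT : X ^ α ≤ ((6 * (m : ℝ)) ^ α) ^ L := by
      rw [Real.rpow_pow_comm h6m0]
      exact Real.rpow_le_rpow hX0 hX6 hα0.le
    have h2L : (2 : ℝ) ≤ 2 ^ L := le_self_pow₀ (by norm_num) hL0
    calc (n₁ : ℝ) ≤ 2 * X ^ α := hc
      _ ≤ 2 ^ L * ((6 * (m : ℝ)) ^ α) ^ L := mul_le_mul h2L hXT hXα0 (by positivity)
      _ = T ^ L := by rw [hT, mul_pow]
  have hnT : (n : ℝ) ≤ T ^ L := by
    rw [hn, Nat.cast_max]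
    exact max_le (hF0.trans (le_self_pow₀ hT1 hL0)) hn₁T
  -- `n ≤ |W|`
  have hnW : n ≤ W.card := by
    have h : (n : ℝ) ≤ (W.card : ℝ) := by
      calc (n : ℝ) ≤ T ^ L := hnT
        _ ≤ ((m : ℝ) ^ (1 / 2 - ε)) ^ L := pow_le_pow_left₀ hT0 hF1 L
        _ = ((m : ℝ) ^ (L : ℝ)) ^ (1 / 2 - ε) := by
            rw [← Real.rpow_mul_natCast hm0R, mul_comm, Real.rpow_mul hm0R]
        _ ≤ W.card := hWcard
    exact_mod_cast h
  /- lift the first `n` code words -/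
  set w : Fin n → Fin L → Fin r := fun i => (W.equivFin.symm (Fin.castLE hnW i)).1 with hw
  have hwW : ∀ i, w i ∈ W := fun i => (W.equivFin.symm (Fin.castLE hnW i)).2
  have hwinj : Function.Injective w := fun i k h =>
    Fin.castLE_injective hnW (W.equivFin.symm.injective (Subtype.ext h))
  obtain ⟨hWA, hXA⟩ := piFinset_sdpp P Q hD w
    (fun i k hik => hCode (w i) (hwW i) (w k) (hwW k) fun h => hik (hwinj h))
  /- transfer into a prime cyclic host -/
  obtain ⟨p, hp, hpR, A', B', hcard, hW', hX'⟩ :=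
    exists_prime_sdpp_of_addEquiv hWA hXA (m := fun _ : Fin L => m) (fun _ => hm1)
      (AddEquiv.refl (Fin L → ZMod m))
  rw [Fin.prod_const] at hpR
  have hpX : (p : ℝ) ≤ X := by rw [hX]; exact_mod_cast hpR
  refine ⟨n, le_max_left _ _, p, hp, A', B', hW', hX', ?_, fun i => ?_⟩
  · /- `p ≤ n ^ (2+δ)` -/
    calc (p : ℝ) ≤ X := hpX
      _ = (X ^ α) ^ (2 + δ) := by rw [hα, Real.rpow_inv_rpow hX0 h2δ.ne']
      _ ≤ (n₁ : ℝ) ^ (2 + δ) := Real.rpow_le_rpow hXα0 (Nat.le_ceil _) h2δ.le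
      _ ≤ (n : ℝ) ^ (2 + δ) :=
          Real.rpow_le_rpow n₁.cast_nonneg (by exact_mod_cast le_max_right n₀ n₁) h2δ.le
  · /- `n ^ (2-δ) ≤ |A' i| |B' i|` -/
    rw [(hcard i).1, (hcard i).2, Fintype.card_piFinset, Fintype.card_piFinset,
      ← prod_mul_distrib]
    push_cast
    calc (n : ℝ) ^ (2 - δ) ≤ (T ^ L) ^ (2 - δ) :=
          Real.rpow_le_rpow n.cast_nonneg hnT (by linarith)
      _ = (T ^ (2 - δ)) ^ L := (Real.rpow_pow_comm hT0 _ _).symm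
      _ ≤ ((m : ℝ) ^ (1 - ε)) ^ L := pow_le_pow_left₀ (Real.rpow_nonneg hT0 _) hF2 L
      _ = ∏ _t : Fin L, (m : ℝ) ^ (1 - ε) := (Fin.prod_const L _).symm
      _ ≤ ∏ t, (((P (w i t)).card : ℝ) * ((Q (w i t)).card : ℝ)) :=
          prod_le_prod (fun _ _ => Real.rpow_nonneg hm0R _) fun t _ => by
            exact_mod_cast hcov (w i t)

end Summit.MatrixMultiplication.MatrixMultiplication.Theorems.PrimeTwoFamilies.CapacityGadgetsK17
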